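import Mathlib

/-!
# Class-sum (orbit) matrices of a conference-type Seidel matrix have trace zero (kernel; the spectral tool)

Framing: lottery ticket; floor = certified bounds/negative ranges.  Cell pub-namedobj (venture DiscreteObjects),
target (H) = `H(668)`, hadamard gen 28; tool file for the automorphism census of `srg(333,166,82,83)` ⇔ symmetric
`C(334)` (⇒ `H(668)`, gen 27).  For an equitable partition of the Seidel matrix `S` (`S² = 333·I − J`, `S𝟙 = 0`,
symmetric) into `t` cells — e.g. the orbits of ANY automorphism group — the class-sum matrix `R` (`t × t`, integer)
satisfies `Σ_j R_{ij} = 0` and `Σ_j R_{ij}R_{jk} = 333[i=k] − n_k` (`ConferenceGraph333TwoCells`), hence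
`R³ = 333·R`; its complex eigenvalues lie in `{0, ±√333}` and, `333` not being a square, **`tr R = 0`**.  This is the
linear condition that, together with entry-wise counting, produces fixed-point windows for automorphisms of each
prime order (Behbahani–Lam-type constraints; our instance).  Contents (Mathlib only):
* **`trace_eq_zero_of_mul_mul_eq_smul`** — an INTEGER square matrix `R` with `R·R·R = c·R`, `c : ℕ` not a square,
  has `trace R = 0`.  Proof: complexify; every root `z` of the characteristic polynomial has an eigenvector, so
  `z³ = c z`, `z ∈ {0, √c, −√c}`; `trace = Σ roots = (n₁ − n₂)√c` (Mathlib `Matrix.trace_eq_sum_roots_charpoly`);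
  an integer, so `n₁ = n₂` by the irrationality of `√c` (`irrational_sqrt_natCast_iff`).
* **`classSum_mul_mul`** — zero row sums and `Σ_j R_{ij}R_{jk} = v[i=k] − n_k` give `R·R·R = v·R` (any `v`, `n`).
* **`classSum_trace_zero`** — the combination: such an `R` with `v = c` non-square has `Σ_i R_{ii} = 0`.
Ours (elementary spectral argument; the orbit-matrix method is Behbahani–Lam 2011 / Crnković–Egan–Švob 2020);
no `sorry`, no new definitions.
-/

namespace Summit.Ventures.DiscreteObjects.Hadamard

open Finset Polynomial
open scoped Matrix

section spectral
variable {ι : Type*} [Fintype ι] [DecidableEq ι]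

/-- every root of the characteristic polynomial of a square matrix over a field has an eigenvector (private copy
of a folklore lemma). -/
private lemma exists_mulVec_eq_smul_of_isRoot {K : Type*} [Field K] (Y : Matrix ι ι K) {y : K}
    (hy : Y.charpoly.IsRoot y) : ∃ u : ι → K, u ≠ 0 ∧ Y *ᵥ u = y • u := by
  have hdet : (Matrix.scalar ι y - Y).det = 0 := by rw [← Matrix.eval_charpoly]; exact hy
  obtain ⟨u, hu, hu0⟩ := Matrix.exists_mulVec_eq_zero_iff.mpr hdet
  refine ⟨u, hu, ?_⟩
  have hsc : Matrix.scalar ι y = y • (1 : Matrix ι ι K) := by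
    rw [Matrix.scalar_apply, ← Matrix.smul_one_eq_diagonal]
  rw [Matrix.sub_mulVec, sub_eq_zero, hsc, Matrix.smul_mulVec, Matrix.one_mulVec] at hu0
  exact hu0.symm

/-- **Trace lemma.**  An integer matrix with `R·R·R = c·R` for a NON-SQUARE natural number `c` has trace `0`
(its complex eigenvalues are `0, ±√c`; the trace `(s − s')√c` is an integer, and `√c` is irrational). -/
theorem trace_eq_zero_of_mul_mul_eq_smul (R : Matrix ι ι ℤ) (c : ℕ) (hc : ¬ IsSquare c)
    (hR : R * R * R = (c : ℤ) • R) : R.trace = 0 := by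
  classical
  set A : Matrix ι ι ℂ := R.map (Int.castRingHom ℂ) with hA
  have hA3 : A * A * A = (c : ℂ) • A := by
    rw [hA, ← Matrix.map_mul, ← Matrix.map_mul, hR]
    ext i j
    rw [Matrix.map_apply, Matrix.smul_apply, Matrix.smul_apply, Matrix.map_apply, smul_eq_mul, smul_eq_mul,
      map_mul, map_natCast]
  set r : ℂ := ((Real.sqrt c : ℝ) : ℂ) with hr
  have hr2 : r * r = c := by
    rw [hr, ← Complex.ofReal_mul, Real.mul_self_sqrt (Nat.cast_nonneg c)]
    simp
  have hc0 : (c : ℂ) ≠ 0 := by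
    have : c ≠ 0 := fun h => hc ⟨0, by simp [h]⟩
    exact_mod_cast this
  have hr0 : r ≠ 0 := fun h => hc0 (by rw [← hr2, h, zero_mul])
  have hrr : r ≠ -r := fun h => hr0 (by
    have : (2 : ℂ) * r = 0 := by linear_combination h
    simpa using this)
  -- eigenvalues
  have hroot : ∀ z ∈ A.charpoly.roots, z = 0 ∨ z = r ∨ z = -r := by
    intro z hz
    have hz' : A.charpoly.IsRoot z := (Polynomial.mem_roots (Matrix.charpoly_monic A).ne_zero).mp hz
    obtain ⟨u, hu0, hu⟩ := exists_mulVec_eq_smul_of_isRoot A hz'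
    have h1 : (A * A) *ᵥ u = (z * z) • u := by
      rw [← Matrix.mulVec_mulVec, hu, Matrix.mulVec_smul, hu, smul_smul]
    have h2 : (A * A * A) *ᵥ u = (z * (z * z)) • u := by
      rw [← Matrix.mulVec_mulVec, hu, Matrix.mulVec_smul, h1, smul_smul]
    have h3 : (A * A * A) *ᵥ u = ((c : ℂ) * z) • u := by
      rw [hA3, Matrix.smul_mulVec, hu, smul_smul]
    have hz3 : z * z * z = c * z := by
      have h : (z * (z * z) - c * z) • u = 0 := by rw [sub_smul, ← h2, ← h3, sub_self]
      rw [mul_assoc]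
      rcases smul_eq_zero.mp h with h | h
      · exact sub_eq_zero.mp h
      · exact absurd h hu0
    have hfac : z * (z - r) * (z + r) = 0 := by
      linear_combination hz3 - z * hr2
    rcases mul_eq_zero.mp hfac with h | h
    · rcases mul_eq_zero.mp h with h | h
      · exact Or.inl h
      · exact Or.inr (Or.inl (sub_eq_zero.mp h))
    · exact Or.inr (Or.inr (eq_neg_of_add_eq_zero_left h))
  -- the root multiset sums to (n₁ − n₂) r
  set M := A.charpoly.roots with hM
  have hsum : ∃ n₁ n₂ : ℕ, M.sum = (n₁ : ℂ) * r - (n₂ : ℂ) * r := by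
    have hsplit := (Multiset.filter_add_not (fun z => z = 0) M)
    set M₁ := M.filter (fun z => ¬ z = 0) with hM₁
    have hM₁mem : ∀ z ∈ M₁, z = r ∨ z = -r := by
      intro z hz
      rw [hM₁, Multiset.mem_filter] at hz
      rcases hroot z hz.1 with h | h
      · exact absurd h hz.2
      · exact h
    have hsplit₁ := (Multiset.filter_add_not (fun z => z = r) M₁)
    set M₂ := M₁.filter (fun z => ¬ z = r) with hM₂
    have hM₂ : M₂ = Multiset.replicate (Multiset.card M₂) (-r) := by
      refine Multiset.eq_replicate.mpr ⟨rfl, fun z hz => ?_⟩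
      rw [hM₂, Multiset.mem_filter] at hz
      rcases hM₁mem z hz.1 with h | h
      · exact absurd h hz.2
      · exact h
    refine ⟨Multiset.count r M₁, Multiset.card M₂, ?_⟩
    have hs0 : (M.filter (fun z => z = 0)).sum = 0 := by
      rw [Multiset.filter_eq', Multiset.sum_replicate, smul_zero]
    have hs1 : (M₁.filter (fun z => z = r)).sum = (Multiset.count r M₁ : ℂ) * r := by
      rw [Multiset.filter_eq', Multiset.sum_replicate, nsmul_eq_mul]
    have hs2 : M₂.sum = (Multiset.card M₂ : ℂ) * (-r) := by
      conv_lhs => rw [hM₂]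
      rw [Multiset.sum_replicate, nsmul_eq_mul]
    have hsumM : M.sum = (Multiset.count r M₁ : ℂ) * r + (Multiset.card M₂ : ℂ) * (-r) := by
      calc M.sum = (M.filter (fun z => z = 0)).sum + M₁.sum := by rw [← Multiset.sum_add, hsplit]
        _ = M₁.sum := by rw [hs0, zero_add]
        _ = (M₁.filter (fun z => z = r)).sum + M₂.sum := by rw [← Multiset.sum_add, hsplit₁]
        _ = _ := by rw [hs1, hs2]
    rw [hsumM]
    ring
  obtain ⟨n₁, n₂, hn⟩ := hsum
  set d : ℤ := (n₁ : ℤ) - n₂ with hd_def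
  have htr : A.trace = (R.trace : ℂ) := by
    rw [hA]
    exact (AddMonoidHom.map_trace (Int.castRingHom ℂ : ℤ →+* ℂ).toAddMonoidHom R).symm
  have hT : ((R.trace : ℤ) : ℂ) = (d : ℂ) * r := by
    rw [← htr, Matrix.trace_eq_sum_roots_charpoly, ← hM, hn, hd_def]
    push_cast
    ring
  by_cases hd0 : d = 0
  · have : ((R.trace : ℤ) : ℂ) = 0 := by rw [hT, hd0]; simp
    exact_mod_cast this
  · exfalso
    -- √c would be rational
    have hirr : Irrational (Real.sqrt c) := irrational_sqrt_natCast_iff.mpr hc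
    have hd : (d : ℝ) ≠ 0 := by exact_mod_cast hd0
    have hreal : ((R.trace : ℤ) : ℝ) = (d : ℝ) * Real.sqrt c := by
      apply Complex.ofReal_injective
      rw [hr] at hT
      push_cast at hT ⊢
      exact hT
    have hsq : Real.sqrt c = ((R.trace : ℤ) : ℝ) / (d : ℝ) := by
      rw [eq_div_iff hd, hreal, mul_comm]
    refine hirr ⟨(R.trace : ℚ) / (d : ℚ), ?_⟩
    push_cast
    exact hsq.symm

end spectral

/-! ## §2 Class-sum matrices: `R·R·R = v·R` from the orbit-matrix identities -/

section classSum
variable {ι : Type*} [Fintype ι] [DecidableEq ι]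

/-- If an integer `t × t` matrix `R` has zero row sums and satisfies `Σ_j R_{ij} R_{jk} = v·[i=k] − n_k` (the class-sum
identities of an equitable partition of a Seidel matrix with `S² = v·I − J`, `S𝟙 = 0`), then `R·R·R = v·R`. -/
theorem classSum_mul_mul (R : Matrix ι ι ℤ) (v : ℤ) (n : ι → ℤ) (hsum : ∀ i, ∑ j, R i j = 0)
    (hRR : ∀ i k, ∑ j, R i j * R j k = v * (if i = k then 1 else 0) - n k) : R * R * R = v • R := by
  have hR2 : R * R = v • (1 : Matrix ι ι ℤ) - Matrix.of (fun _ k => n k) := by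
    ext i k
    rw [Matrix.mul_apply, hRR i k, Matrix.sub_apply, Matrix.smul_apply, Matrix.one_apply, Matrix.of_apply, smul_eq_mul,
      mul_ite, mul_one, mul_zero]
  rw [Matrix.mul_assoc, hR2, Matrix.mul_sub, Matrix.mul_smul, Matrix.mul_one]
  have : R * Matrix.of (fun (_ : ι) k => n k) = 0 := by
    ext i k
    rw [Matrix.mul_apply]
    simp only [Matrix.of_apply, Matrix.zero_apply]
    rw [← Finset.sum_mul, hsum i, zero_mul]
  rw [this, sub_zero]

/-- **Class-sum matrices have trace zero.**  Zero row sums and `Σ_j R_{ij}R_{jk} = c[i=k] − n_k` with `c` a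
non-square natural number force `Σ_i R_{ii} = 0`. -/
theorem classSum_trace_zero (R : Matrix ι ι ℤ) (c : ℕ) (hc : ¬ IsSquare c) (n : ι → ℤ)
    (hsum : ∀ i, ∑ j, R i j = 0) (hRR : ∀ i k, ∑ j, R i j * R j k = (c : ℤ) * (if i = k then 1 else 0) - n k) :
    ∑ i, R i i = 0 := by
  have h := trace_eq_zero_of_mul_mul_eq_smul R c hc (classSum_mul_mul R c n hsum hRR)
  simpa [Matrix.trace] using h

end classSum

end Summit.Ventures.DiscreteObjects.Hadamard
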